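import Summits.KontsevichZagierPeriods.KontsevichZagierPeriods.Theses.SymplecticScissors
import Literature.NumberTheory.Transcendental.CurvePeriodsPathConnectedProofs
import Literature.NumberTheory.Transcendental.KZSemialgebraicComplex
import Literature.NumberTheory.Transcendental.KZPeriodsProofs
import Literature.NumberTheory.Transcendental.SemialgebraicMapsProofs

/-!
# `RealOnePeriodRelations` (stmt-KontsevichZagierPeriods-10042, route SymplecticScissors), line
# `nash-retraction-thin-strip`: stub `stub_saPathSubset`, auxiliary file — semialgebraicity of
# the path constructions

Toolkit for the stub `stub_saPathSubset` (file `…StubSaPathSubset.lean`: a continuous path on a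
smooth affine curve `Z ⊂ ℂⁿ` over `ℚ̄` inside an open `G`, with algebraic end points, is
replaced by a `ℚ`-SEMIALGEBRAIC `C¹` path in `G` with the same end points). A path
`γ : [0,1] → ℂⁿ` is handled through its realification `z ↦ (re γ(z₀), im γ(z₀))`,
`ℝ¹ ⊃ [0,1] → ℝ²ⁿ` (`Fin.append`), and "semialgebraic" means that this is an
`IsSemialgebraicMapOn ℚ` on `{z | z 0 ∈ [0,1]}`. We show that the three constructions of the
tree's `CurvePeriods.exists_curvePath_subset` preserve semialgebraicity:

* `sa_const` — constant paths at algebraic points (real algebraic constants are `ℚ`-definable);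
* `helper_saPathSubset_1` (the registered anchor of this file) — `CurvePeriods.CurvePath.concat`,
  whose reparametrisation is the POLYNOMIAL flat cubic `φ(s) = 3s² − 2s³` (composition of
  semialgebraic maps, union of two graphs);
* `sa_chartSegment` — chart-straight paths `t ↦ ψ((1 − t) b₀ + t b₁)` for a chart `ψ` which
  is (realified) `ℚ`-semialgebraic on a closed disc containing the algebraic points `b₀, b₁`;

and `exists_chart_subset` shrinks the semialgebraic graph charts of the line (hypothesis of the
stub, = stub `stub_saChart`) to convex chart pieces inside a prescribed open set `G`.

References: J. Bochnak, M. Coste, M.-F. Roy, *Real Algebraic Geometry* (1998), §2.2 (Def. 2.2.5,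
Prop. 2.2.6); M. Kontsevich, D. Zagier, *Periods* (2001), §1.1; A. Huber, G. Wüstholz,
*Transcendence and Linear Relations of 1-Periods* (CUP 2022), §3.3.1.
-/

noncomputable section

open scoped BigOperators Topology
open Set Filter MvPolynomial
open Literature.NumberTheory.Transcendental Literature.NumberTheory.Transcendental.CurvePeriods
open Literature.ModelTheory.ExponentialFields (IsSemialgebraic)

namespace Summit.KontsevichZagierPeriods.SymplecticScissors.RealOnePeriodRelations

namespace SaPathSubset

/-! ## Semialgebraic bookkeeping -/

/-- A closed slab `{z | a ≤ z 0 ≤ b} ⊂ ℝ¹` with rational ends is `ℚ`-semialgebraic.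
[folklore] -/
theorem isSemialgebraic_slab (a b : ℚ) :
    IsSemialgebraic ℚ {z : Fin 1 → ℝ | z 0 ∈ Icc (a : ℝ) b} := by
  have h1 := Literature.ModelTheory.ExponentialFields.isSemialgebraic_setOf_eval_le (k := ℚ)
    (R := ℝ) (C a : MvPolynomial (Fin 1) ℚ) (X 0)
  have h2 := Literature.ModelTheory.ExponentialFields.isSemialgebraic_setOf_eval_le (k := ℚ)
    (R := ℝ) (X 0 : MvPolynomial (Fin 1) ℚ) (C b)
  have he : {z : Fin 1 → ℝ | z 0 ∈ Icc (a : ℝ) b} =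
      {z : Fin 1 → ℝ | aeval z (C a : MvPolynomial (Fin 1) ℚ) ≤
          aeval z (X 0 : MvPolynomial (Fin 1) ℚ)} ∩
        {z : Fin 1 → ℝ | aeval z (X 0 : MvPolynomial (Fin 1) ℚ) ≤
          aeval z (C b : MvPolynomial (Fin 1) ℚ)} := by
    ext z
    simp only [mem_setOf_eq, mem_Icc, mem_inter_iff, aeval_X, aeval_C, eq_ratCast]
  rw [he]
  exact h1.inter h2

/-- **Gluing two semialgebraic maps**: a map agreeing with a semialgebraic map on `s` and with a
semialgebraic map on `t` is semialgebraic on `s ∪ t` (its graph is the union of the two graphs).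
[cite: BochnakCosteRoy1998, §2.2 (Def. 2.2.5)] -/
theorem saMap_union {m n : ℕ} {s t : Set (Fin m → ℝ)}
    {f g F : (Fin m → ℝ) → (Fin n → ℝ)}
    (hf : IsSemialgebraicMapOn ℚ s f) (hg : IsSemialgebraicMapOn ℚ t g) (hfs : EqOn F f s)
    (hgt : EqOn F g t) : IsSemialgebraicMapOn ℚ (s ∪ t) F := by
  unfold IsSemialgebraicMapOn at hf hg ⊢
  convert hf.union hg using 1
  ext z
  simp only [mem_setOf_eq, mem_union]
  constructor
  · rintro ⟨x, hx | hx, h⟩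
    · exact Or.inl ⟨x, hx, by rw [h, hfs hx]⟩
    · exact Or.inr ⟨x, hx, by rw [h, hgt hx]⟩
  · rintro (⟨x, hx, h⟩ | ⟨x, hx, h⟩)
    · exact ⟨x, Or.inl hx, by rw [h, hfs hx]⟩
    · exact ⟨x, Or.inr hx, by rw [h, hgt hx]⟩

/-- **Realification.** A `ℂⁿ`-valued function on a `ℚ`-semialgebraic `s ⊆ ℝᵐ` all of whose
coordinates have `ℚ`-semialgebraic real and imaginary parts is, realified as
`x ↦ (re F(x), im F(x)) ∈ ℝ²ⁿ`, a `ℚ`-semialgebraic map (coordinatewise; no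
Tarski–Seidenberg). [cite: BochnakCosteRoy1998, §2.2 (Def. 2.2.5)] -/
theorem saMap_reIm {m n : ℕ} {s : Set (Fin m → ℝ)} (hs : IsSemialgebraic ℚ s)
    {F : (Fin m → ℝ) → (Fin n → ℂ)}
    (h : ∀ i, IsSemialgebraicFunOn ℚ s (fun x => (F x i).re) ∧
      IsSemialgebraicFunOn ℚ s (fun x => (F x i).im)) :
    IsSemialgebraicMapOn ℚ s
      (fun x => Fin.append (fun i => (F x i).re) (fun i => (F x i).im)) := by
  refine IsSemialgebraicMapOn.of_forall hs fun l => ?_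
  refine Fin.addCases (motive := fun l => IsSemialgebraicFunOn ℚ s
    fun x => Fin.append (fun i => (F x i).re) (fun i => (F x i).im) l) (fun i => ?_)
    (fun j => ?_) l
  · simpa only [Fin.append_left] using (h i).1
  · simpa only [Fin.append_right] using (h j).2

/-! ## Constant paths and chart segments are semialgebraic -/

/-- The constant path at an algebraic point is a `ℚ`-semialgebraic map on `[0,1]` (real and
imaginary parts of algebraic numbers are real algebraic, hence `ℚ`-definable constants).
[cite: KontsevichZagier2001, §1.1] -/
theorem sa_const {Z : CurveData} (p : Fin Z.n → ℂ) (hp : p ∈ Z.points)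
    (ha : ∀ i, IsAlgebraic ℚ (p i)) :
    IsSemialgebraicMapOn ℚ {z : Fin 1 → ℝ | z 0 ∈ Icc (0 : ℝ) 1}
      (fun z => Fin.append (fun i => ((CurvePath.const p hp ha).toFun (z 0) i).re)
        (fun i => ((CurvePath.const p hp ha).toFun (z 0) i).im)) := by
  have hD : IsSemialgebraic ℚ {z : Fin 1 → ℝ | z 0 ∈ Icc (0 : ℝ) 1} := by
    simpa using isSemialgebraic_slab 0 1
  exact saMap_reIm hD (F := fun _ => p) fun i =>
    re_im_const hD (isAlgebraic_re_im (ha i)).1 (isAlgebraic_re_im (ha i)).2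

/-- The reparametrisation `z ↦ φ(a z₀ + b)` (`φ(t) = t²(3 − 2t)` the flat cubic of
`CurvePath.concat`, `a, b ∈ ℚ`) is a polynomial map `ℝ¹ → ℝ¹` over `ℚ`, hence
`ℚ`-semialgebraic on any `ℚ`-semialgebraic set. [cite: BochnakCosteRoy1998, §2.2] -/
theorem saMap_smoothStep_affine {s : Set (Fin 1 → ℝ)} (hs : IsSemialgebraic ℚ s) (a b : ℚ) :
    IsSemialgebraicMapOn ℚ s (fun z => fun _ : Fin 1 => smoothStep ((a : ℝ) * z 0 + b)) := by
  set T : MvPolynomial (Fin 1) ℚ := C a * X 0 + C b with hT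
  refine (isSemialgebraicMapOn_aeval hs (fun _ : Fin 1 => T * T * (3 - 2 * T))).congr
    fun z _ => ?_
  funext j
  simp only [hT, smoothStep, map_mul, map_sub, map_add, aeval_X, aeval_C, eq_ratCast, map_ofNat]

/-- **Chart-straight paths are semialgebraic.** If the chart `ψ : ℂ → ℂⁿ` is (realified) a
`ℚ`-semialgebraic map on the closed disc `closedBall c ρ` and `b₀, b₁ ∈ closedBall c ρ` are
algebraic, then `t ↦ ψ((1 − t) b₀ + t b₁)` is (realified) a `ℚ`-semialgebraic map on `[0,1]`:
the segment `t ↦ (1 − t) b₀ + t b₁` has `ℚ`-semialgebraic real and imaginary parts (algebraic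
constants, `KZSemialgebraicComplex`), stays in the convex disc, and semialgebraic maps compose
(Tarski–Seidenberg). [cite: BochnakCosteRoy1998, Prop. 2.2.6] -/
theorem sa_chartSegment {n : ℕ} {ψ : ℂ → (Fin n → ℂ)} {c : ℂ} {ρ : ℝ}
    (hSA : IsSemialgebraicMapOn ℚ
      {q : Fin 2 → ℝ | (⟨q 0, q 1⟩ : ℂ) ∈ Metric.closedBall c ρ}
      (fun q => Fin.append (fun i => (ψ ⟨q 0, q 1⟩ i).re) (fun i => (ψ ⟨q 0, q 1⟩ i).im)))
    {b₀ b₁ : ℂ} (hb₀ : b₀ ∈ Metric.closedBall c ρ) (hb₁ : b₁ ∈ Metric.closedBall c ρ)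
    (ha₀ : IsAlgebraic ℚ b₀) (ha₁ : IsAlgebraic ℚ b₁) :
    IsSemialgebraicMapOn ℚ {z : Fin 1 → ℝ | z 0 ∈ Icc (0 : ℝ) 1}
      (fun z => Fin.append (fun i => (ψ (segPoint b₀ b₁ (z 0)) i).re)
        (fun i => (ψ (segPoint b₀ b₁ (z 0)) i).im)) := by
  have hD : IsSemialgebraic ℚ {z : Fin 1 → ℝ | z 0 ∈ Icc (0 : ℝ) 1} := by
    simpa using isSemialgebraic_slab 0 1
  -- the segment, realified: `z ↦ (re, im) ((1 − z₀) b₀ + z₀ b₁)`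
  have hseg : IsSemialgebraicFunOn ℚ {z : Fin 1 → ℝ | z 0 ∈ Icc (0 : ℝ) 1}
      (fun z => (segPoint b₀ b₁ (z 0)).re) ∧
      IsSemialgebraicFunOn ℚ {z : Fin 1 → ℝ | z 0 ∈ Icc (0 : ℝ) 1}
      (fun z => (segPoint b₀ b₁ (z 0)).im) := by
    have h1t : IsSemialgebraicFunOn ℚ {z : Fin 1 → ℝ | z 0 ∈ Icc (0 : ℝ) 1}
        (fun z => 1 - z 0) :=
      (isSemialgebraicFunOn_aeval hD (1 - X 0 : MvPolynomial (Fin 1) ℚ)).congr fun z _ => by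
        simp
    have h := re_im_add
      (re_im_mul (re_im_ofReal hD h1t)
        (re_im_const hD (isAlgebraic_re_im ha₀).1 (isAlgebraic_re_im ha₀).2))
      (re_im_mul (re_im_coord hD)
        (re_im_const hD (isAlgebraic_re_im ha₁).1 (isAlgebraic_re_im ha₁).2))
    simpa only [segPoint] using h
  set w : (Fin 1 → ℝ) → (Fin 2 → ℝ) :=
    fun z => ![(segPoint b₀ b₁ (z 0)).re, (segPoint b₀ b₁ (z 0)).im] with hw
  have hwSA : IsSemialgebraicMapOn ℚ {z : Fin 1 → ℝ | z 0 ∈ Icc (0 : ℝ) 1} w := by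
    refine IsSemialgebraicMapOn.of_forall hD fun j => ?_
    fin_cases j
    · simpa [hw] using hseg.1
    · simpa [hw] using hseg.2
  have hq : ∀ z, (⟨w z 0, w z 1⟩ : ℂ) = segPoint b₀ b₁ (z 0) := fun z => by simp [hw]
  have hwm : MapsTo w {z : Fin 1 → ℝ | z 0 ∈ Icc (0 : ℝ) 1}
      {q : Fin 2 → ℝ | (⟨q 0, q 1⟩ : ℂ) ∈ Metric.closedBall c ρ} := by
    intro z hz
    show (⟨w z 0, w z 1⟩ : ℂ) ∈ Metric.closedBall c ρ
    rw [hq]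
    exact segPoint_mem (convex_closedBall c ρ) hb₀ hb₁ hz
  refine (IsSemialgebraicMapOn.comp_holds hSA hwSA hwm).congr fun z _ => ?_
  simp only [Function.comp_apply, hq]

/-! ## Charts inside a prescribed open set -/

/-- **Semialgebraic chart pieces inside `G`.** From the semialgebraic graph charts (hypothesis
of the stub) one gets, at every point `x ∈ Z(ℂ) ∩ G`: a coordinate `i₀`, a CONVEX set `T ⊂ ℂ`
of chart parameters on which `ψ` is holomorphic with values in `Z(ℂ) ∩ G`, contained in a closed
disc on which `ψ` is (realified) `ℚ`-semialgebraic, and an open `Ω ∋ x` whose points on `Z`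
have `i₀`-th coordinate in `T` and are recovered by `ψ` — shrink the chart disc to a small ball
around `x i₀` inside `ψ⁻¹(G)` and inside `closedBall c ρ`. [cite: HuberWustholz2022, §3.3.1] -/
theorem exists_chart_subset
    (H : ∀ (Z : CurveData), Z.IsSmoothAffineCurve → ∀ z₀ ∈ Z.points,
      ∃ (i₀ : Fin Z.n) (c : ℂ) (ε ρ : ℝ) (Ω : Set (Fin Z.n → ℂ)) (ψ : ℂ → (Fin Z.n → ℂ)),
        0 < ρ ∧ ρ < ε ∧ IsOpen Ω ∧ z₀ ∈ Ω ∧ z₀ i₀ ∈ Metric.ball c (ρ / 6) ∧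
        AnalyticOnNhd ℂ ψ (Metric.ball c ε) ∧
        (∀ z ∈ Ω, z ∈ Z.points → z i₀ ∈ Metric.ball c ε ∧ ψ (z i₀) = z) ∧
        (∀ w ∈ Metric.ball c ε, ψ w ∈ Ω ∧ ψ w ∈ Z.points ∧ ψ w i₀ = w) ∧
        IsSemialgebraicMapOn ℚ {q : Fin 2 → ℝ | (⟨q 0, q 1⟩ : ℂ) ∈ Metric.closedBall c ρ}
          (fun q => Fin.append (fun i => (ψ ⟨q 0, q 1⟩ i).re) (fun i => (ψ ⟨q 0, q 1⟩ i).im)))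
    {Z : CurveData} (hZ : Z.IsSmoothAffineCurve) {G : Set (Fin Z.n → ℂ)} (hG : IsOpen G)
    {x : Fin Z.n → ℂ} (hx : x ∈ Z.points ∩ G) :
    ∃ (i₀ : Fin Z.n) (T : Set ℂ) (Ω : Set (Fin Z.n → ℂ)) (ψ : ℂ → (Fin Z.n → ℂ)) (c : ℂ)
      (ρ : ℝ), Convex ℝ T ∧ IsOpen Ω ∧ x ∈ Ω ∧ AnalyticOnNhd ℂ ψ T ∧
      (∀ z ∈ Ω, z ∈ Z.points → z i₀ ∈ T ∧ ψ (z i₀) = z) ∧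
      MapsTo ψ T Z.points ∧ MapsTo ψ T G ∧ T ⊆ Metric.closedBall c ρ ∧
      IsSemialgebraicMapOn ℚ {q : Fin 2 → ℝ | (⟨q 0, q 1⟩ : ℂ) ∈ Metric.closedBall c ρ}
        (fun q => Fin.append (fun i => (ψ ⟨q 0, q 1⟩ i).re) (fun i => (ψ ⟨q 0, q 1⟩ i).im)) := by
  obtain ⟨i₀, c, ε, ρ, Ω, ψ, hρ, hρε, hΩo, hxΩ, hxc, hψ, h1, h2, hSA⟩ := H Z hZ x hx.1
  obtain ⟨hxε, hψx⟩ := h1 x hxΩ hx.1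
  -- shrink the disc so that `ψ` takes values in `G`
  have hcont : ContinuousAt ψ (x i₀) := (hψ (x i₀) hxε).continuousAt
  have hpre : ψ ⁻¹' G ∈ 𝓝 (x i₀) :=
    hcont.preimage_mem_nhds (hG.mem_nhds (by rw [hψx]; exact hx.2))
  obtain ⟨δ₁, hδ₁, hball⟩ := Metric.mem_nhds_iff.mp hpre
  set δ := min δ₁ (ρ / 6) with hδ
  have hδpos : 0 < δ := lt_min hδ₁ (by positivity)
  have hTρ' : Metric.ball (x i₀) δ ⊆ Metric.ball c (ρ / 3) := fun w hw => by
    rw [Metric.mem_ball] at hw hxc ⊢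
    calc dist w c ≤ dist w (x i₀) + dist (x i₀) c := dist_triangle _ _ _
      _ < δ + ρ / 6 := add_lt_add hw hxc
      _ ≤ ρ / 6 + ρ / 6 := by gcongr; exact min_le_right _ _
      _ = ρ / 3 := by ring
  have hTε : Metric.ball (x i₀) δ ⊆ Metric.ball c ε :=
    hTρ'.trans (Metric.ball_subset_ball (by linarith))
  have hTρ : Metric.ball (x i₀) δ ⊆ Metric.closedBall c ρ :=
    hTρ'.trans (Metric.ball_subset_closedBall.trans
      (Metric.closedBall_subset_closedBall (by linarith)))
  refine ⟨i₀, Metric.ball (x i₀) δ,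
    Ω ∩ (fun z : Fin Z.n → ℂ => z i₀) ⁻¹' Metric.ball (x i₀) δ, ψ, c, ρ, convex_ball _ _,
    hΩo.inter (Metric.isOpen_ball.preimage (continuous_apply i₀)),
    ⟨hxΩ, Metric.mem_ball_self hδpos⟩, hψ.mono hTε,
    fun z hz hzZ => ⟨hz.2, (h1 z hz.1 hzZ).2⟩, fun w hw => (h2 w (hTε hw)).2.1,
    fun w hw => hball (Metric.ball_subset_ball (min_le_left _ _) hw), hTρ, hSA⟩

end SaPathSubset

/-! ## Registered anchor: concatenation -/

open SaPathSubset in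
/-- **Anchor `helper_saPathSubset_1`** (registered helper stub of `stub_saPathSubset`) —
**concatenation preserves semialgebraicity.** If two `C¹` paths on `Z` are `ℚ`-semialgebraic
maps on `[0,1]` (realified), so is their concatenation `CurvePath.concat`: on `[0, 1/2]` it is
the first path composed with the polynomial `φ(2t)`, on `[1/2, 1]` the second composed with
`φ(2t − 1)` (composition of semialgebraic maps, Tarski–Seidenberg), and the graph is the union
of the two pieces. [cite: BochnakCosteRoy1998, Prop. 2.2.6] -/
theorem helper_saPathSubset_1 : ∀ {Z : CurveData} (γ₁ γ₂ : CurvePath Z) (hj : γ₁.toFun 1 = γ₂.toFun 0), IsSemialgebraicMapOn ℚ {z : Fin 1 → ℝ | z 0 ∈ Set.Icc (0 : ℝ) 1} (fun z => Fin.append (fun i => (γ₁.toFun (z 0) i).re) (fun i => (γ₁.toFun (z 0) i).im)) → IsSemialgebraicMapOn ℚ {z : Fin 1 → ℝ | z 0 ∈ Set.Icc (0 : ℝ) 1} (fun z => Fin.append (fun i => (γ₂.toFun (z 0) i).re) (fun i => (γ₂.toFun (z 0) i).im)) → IsSemialgebraicMapOn ℚ {z : Fin 1 → ℝ | z 0 ∈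 Set.Icc (0 : ℝ) 1} (fun z => Fin.append (fun i => ((γ₁.concat γ₂ hj).toFun (z 0) i).re) (fun i => ((γ₁.concat γ₂ hj).toFun (z 0) i).im)) := by
  intro Z γ₁ γ₂ hj h₁ h₂
  have hD₁ : IsSemialgebraic ℚ {z : Fin 1 → ℝ | z 0 ∈ Icc (0 : ℝ) (1 / 2)} := by
    simpa using isSemialgebraic_slab 0 (1 / 2)
  have hD₂ : IsSemialgebraic ℚ {z : Fin 1 → ℝ | z 0 ∈ Icc (1 / 2 : ℝ) 1} := by
    simpa using isSemialgebraic_slab (1 / 2) 1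
  have hunion : {z : Fin 1 → ℝ | z 0 ∈ Icc (0 : ℝ) 1} =
      {z : Fin 1 → ℝ | z 0 ∈ Icc (0 : ℝ) (1 / 2)} ∪
        {z : Fin 1 → ℝ | z 0 ∈ Icc (1 / 2 : ℝ) 1} := by
    ext z
    simp only [mem_setOf_eq, mem_union, mem_Icc]
    constructor
    · intro h
      rcases le_or_gt (z 0) (1 / 2) with hle | hlt
      · exact Or.inl ⟨h.1, hle⟩
      · exact Or.inr ⟨hlt.le, h.2⟩
    · rintro (h | h)
      · exact ⟨h.1, h.2.trans (by norm_num)⟩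
      · exact ⟨le_trans (by norm_num) h.1, h.2⟩
  -- the two reparametrisations
  have hu₁ : IsSemialgebraicMapOn ℚ {z : Fin 1 → ℝ | z 0 ∈ Icc (0 : ℝ) (1 / 2)}
      (fun z => fun _ : Fin 1 => smoothStep (2 * z 0)) := by
    simpa using saMap_smoothStep_affine hD₁ 2 0
  have hu₂ : IsSemialgebraicMapOn ℚ {z : Fin 1 → ℝ | z 0 ∈ Icc (1 / 2 : ℝ) 1}
      (fun z => fun _ : Fin 1 => smoothStep (2 * z 0 - 1)) := by
    simpa [sub_eq_add_neg] using saMap_smoothStep_affine hD₂ 2 (-1)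
  have hm₁ : MapsTo (fun z => fun _ : Fin 1 => smoothStep (2 * z 0))
      {z : Fin 1 → ℝ | z 0 ∈ Icc (0 : ℝ) (1 / 2)} {z : Fin 1 → ℝ | z 0 ∈ Icc (0 : ℝ) 1} :=
    fun z hz => mapsTo_smoothStep (two_mul_mem_Icc hz)
  have hm₂ : MapsTo (fun z => fun _ : Fin 1 => smoothStep (2 * z 0 - 1))
      {z : Fin 1 → ℝ | z 0 ∈ Icc (1 / 2 : ℝ) 1} {z : Fin 1 → ℝ | z 0 ∈ Icc (0 : ℝ) 1} :=
    fun z hz => mapsTo_smoothStep (two_mul_sub_one_mem_Icc hz)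
  have hc₁ := IsSemialgebraicMapOn.comp_holds h₁ hu₁ hm₁
  have hc₂ := IsSemialgebraicMapOn.comp_holds h₂ hu₂ hm₂
  rw [hunion]
  refine saMap_union hc₁ hc₂ (fun z hz => ?_) (fun z hz => ?_)
  · simp only [Function.comp_apply, CurvePath.concat_apply, if_pos hz.2]
  · rcases lt_or_eq_of_le hz.1 with hlt | heq
    · simp only [Function.comp_apply, CurvePath.concat_apply, if_neg (not_le.mpr hlt)]
    · have h12 : (γ₁.concat γ₂ hj).toFun (z 0) = γ₂.toFun (smoothStep (2 * z 0 - 1)) := by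
        rw [← heq, CurvePath.concat_half]
        norm_num
      simp only [Function.comp_apply, h12]

end Summit.KontsevichZagierPeriods.SymplecticScissors.RealOnePeriodRelations

end
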